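import Literature.MathematicalPhysics.QuantumFieldTheory.Balaban1983to89.B8Eq138LandauZd

/-!
# `Balaban1983to89.B8Eq191FlatDirichletForm` — [Balaban1985RegularSpaces] (1.91) p. 91 ∕ (1.95) p. 92 AT `U₀ = 1`: the QUADRATIC FORM of the flat
# Dirichlet operator `Δ + Q′ᵀaQ′` on a finite region `Ω₀ ⊂ ℤᵈ` is POSITIVE DEFINITE — [B6] p. 235 «Of course the operator … is positive definite,
# so its inverse is well defined» in the Dirichlet reading of [4] p. 394 — hence its real matrix is invertible (the existence of `G′(1)`)

statement-level skeleton of published theorems with citation tags; proofs where landed; nothing here is a claim about the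
Yang–Mills mass gap

T. Bałaban, *Spaces of regular gauge field configurations on a lattice and gauge fixing conditions*, Commun. Math. Phys. **99**
(1985) 75–102 `[Balaban1985RegularSpaces]` ("B8"), (1.91) p. 91, (1.95) p. 92 («`G′ = (Δ + Q′*aQ′)⁻¹`»); [4] = T. Bałaban, *Propagators for
lattice gauge theories in a background field*, Commun. Math. Phys. **99** (1985) 389–434 `[Balaban1985BackgroundPropagators]`, (3.23)–(3.25) p. 394
(«the operator `Δ′_a` with Dirichlet boundary conditions on `∂Ω₀` … Its inverse is denoted by `G′`»); [B6] = T. Bałaban, *Propagators and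
renormalization transformations for lattice gauge theories. II*, Commun. Math. Phys. **96** (1984) 223–250 `[Balaban1984PropagatorsII]`, p. 235.

CITATION HEADER (lean-in-tree rule).  Cell `pub-ymgap` (YM Track A, HUMAN RULING D-0062), DAG node N05 = [B8], seat `pub-ymgap-dag-n05-e` (g3;
director-ym R141 (C), FAN-OUT §N05 row s3b successor — THE FLAT CURRENCY for Proposition 6).  Companion of `B8Eq191FlatStencils` (the flat
operator `Δ + Q′ᵀaQ′` at `U₀ = 1` on functions supported in a finite `S ⊂ ℤᵈ` has the explicit real kernel
`K(x, z) = η⁻²Σ_μ(2[z = x] − [z = x + e_μ] − [z = x − e_μ]) + Σ_{j ≤ m} a_j L^{−2dj}[y_j(x) ∈ Λ_j ∧ y_j(z) = y_j(x)]`).  THIS FILE is the REAL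
LINEAR ALGEBRA of that kernel — no `𝔸`, no operator of the tree is unfolded here:
* §1 the Dirichlet-Laplacian part of the quadratic form in the manifestly non-negative shape
  `Σ_{x,z∈S} v_x(2[z=x] − [z=x+e_μ] − [z=x−e_μ])v_z = Σ_{x∈S}(v_x − v_{x+e_μ})² + Σ_{x∈S, x−e_μ∉S} v_x²` for `v` supported in `S`
  (`quadForm_lap_flat_eq`; summation by parts on `ℤᵈ` with finite support);
* §2 its vanishing forces `v = 0` on a FINITE `S` (`eq_zero_of_lapForm_eq_zero`: walk each site along `−e_μ` out of `S` — the Dirichlet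
  boundary is where the form sees `v_x²`);
* §3 the averaging part `Σ_{x,z∈S} v_x[y(x) ∈ Λ ∧ y(z) = y(x)]c·v_z = c·Σ_y[y ∈ Λ](Σ_{y(x)=y} v_x)² ≥ 0` (`quadForm_gram_nonneg`, a Gram form);
* §4 the whole form: `Σ_{x,z∈S} v_xK(x,z)v_z = 0 ⇒ v = 0` (`eq_zero_of_quadForm_flat_eq_zero`; `η ≠ 0`, `a_j ≥ 0`, `d ≥ 1`);
* §5 hence the real matrix `(K(x,z))_{x,z∈S}` has injective `mulVec` and IS A UNIT (`flatMatrix_mulVec_injective`, `isUnit_flatMatrix`) — the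
  existence of the flat Dirichlet Green's function `G′(1) = K⁻¹` consumed by `B8Eq191FlatGreenDirichlet`.
The kernel enters through a letter `K` with its defining equation `hK` (no definition is introduced).

HONEST SCOPE.  Finite-dimensional real linear algebra; no estimate (nothing of (1.92) ∕ (1.98) ∕ (1.101)); nothing of [4] ∕ [B6] beyond the quoted
positivity sentence, here PROVED for the Dirichlet compression.  Count-neutral; N05 NOT discharged; one finite `T⁴` programme at fixed `ε`, Bałaban
as printed; nothing continuum ∕ ℝ⁴ ∕ OS ∕ mass-gap ∕ Clay.  No `sorry`, no `def`, no `instance`, no `notation`.  Unit `pub-ymgap-dag-n05-e` (g3), 2026-08-27.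
-/

noncomputable section

namespace Literature.MathematicalPhysics.QuantumFieldTheory.Balaban1983to89.B8Eq191FlatDirichletForm

open Finset
open B7Prop1Explicit (e)
open Literature.MathematicalPhysics.QuantumLattice (blockMap)

variable {d : ℕ}

/-! ## §1 The Dirichlet-Laplacian part of the quadratic form -/

/-- Kronecker sums of a function supported in `S`: `Σ_{z∈S}[z = w]v(z) = v(w)`. [folklore]
[cite: Balaban1985BackgroundPropagators, (3.24) p.394] -/
theorem sum_ite_eq_of_supp (S : Finset (Fin d → ℤ)) (v : (Fin d → ℤ) → ℝ) (hv : ∀ w, w ∉ S → v w = 0) (w : Fin d → ℤ) :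
    ∑ z ∈ S, (if z = w then v z else 0) = v w := by
  rw [Finset.sum_ite_eq']
  by_cases hw : w ∈ S
  · rw [if_pos hw]
  · rw [if_neg hw, hv w hw]

/-- `Σ_{z∈S}[z = w] = [w ∈ S]`. [folklore] [cite: Balaban1985BackgroundPropagators, (3.24) p.394] -/
theorem sum_ite_one_eq (S : Finset (Fin d → ℤ)) (w : Fin d → ℤ) :
    ∑ z ∈ S, (if z = w then (1 : ℝ) else 0) = if w ∈ S then 1 else 0 :=
  Finset.sum_ite_eq' S w fun _ => (1 : ℝ)

/-- Reindexing a nearest-neighbour correlation over a finite support: `Σ_{x∈S} v(x)v(x − e_μ) = Σ_{x∈S} v(x)v(x + e_μ)`.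
[folklore] [cite: Balaban1985BackgroundPropagators, (3.23) p.394] -/
theorem sum_mul_shift_eq (S : Finset (Fin d → ℤ)) (v : (Fin d → ℤ) → ℝ) (hv : ∀ w, w ∉ S → v w = 0) (μ : Fin d) :
    ∑ x ∈ S, v x * v (x - e μ) = ∑ x ∈ S, v x * v (x + e μ) := by
  have h1 : ∀ x, v x * v (x - e μ) = ∑ z ∈ S, (if z = x - e μ then v x * v z else 0) := by
    intro x
    rw [← sum_ite_eq_of_supp S v hv (x - e μ), Finset.mul_sum]
    exact Finset.sum_congr rfl fun z _ => by split_ifs <;> simp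
  have h2 : ∀ z, v z * v (z + e μ) = ∑ x ∈ S, (if x = z + e μ then v x * v z else 0) := by
    intro z
    rw [← sum_ite_eq_of_supp S v hv (z + e μ), Finset.mul_sum]
    exact Finset.sum_congr rfl fun x _ => by split_ifs <;> ring
  rw [Finset.sum_congr rfl fun x _ => h1 x, Finset.sum_comm, Finset.sum_congr rfl fun z _ => h2 z]
  refine Finset.sum_congr rfl fun z _ => Finset.sum_congr rfl fun x _ => ?_
  have : (z = x - e μ) ↔ (x = z + e μ) := by
    constructor
    · intro h; rw [h, sub_add_cancel]
    · intro h; rw [h, add_sub_cancel_right]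
  simp only [this]

/-- The shifted squares over a finite support: `Σ_{x∈S} v(x + e_μ)² = Σ_{x∈S, x−e_μ∈S} v(x)²`.
[folklore] [cite: Balaban1985BackgroundPropagators, (3.23) p.394] -/
theorem sum_sq_shift_eq (S : Finset (Fin d → ℤ)) (v : (Fin d → ℤ) → ℝ) (hv : ∀ w, w ∉ S → v w = 0) (μ : Fin d) :
    ∑ x ∈ S, v (x + e μ) ^ 2 = ∑ x ∈ S, (if x - e μ ∈ S then v x ^ 2 else 0) := by
  have hv2 : ∀ w, w ∉ S → (fun w => v w ^ 2) w = 0 := fun w hw => by simp [hv w hw]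
  have h1 : ∀ x, v (x + e μ) ^ 2 = ∑ z ∈ S, (if z = x + e μ then v z ^ 2 else 0) := fun x =>
    (sum_ite_eq_of_supp S (fun w => v w ^ 2) hv2 (x + e μ)).symm
  rw [Finset.sum_congr rfl fun x _ => h1 x, Finset.sum_comm]
  refine Finset.sum_congr rfl fun z _ => ?_
  have : ∀ x, (z = x + e μ) ↔ (x = z - e μ) := fun x => by
    constructor
    · intro h; rw [h, add_sub_cancel_right]
    · intro h; rw [h, sub_add_cancel]
  simp only [this]
  rw [show (∑ x ∈ S, if x = z - e μ then v z ^ 2 else (0 : ℝ)) = (∑ x ∈ S, if x = z - e μ then (1 : ℝ) else 0) * v z ^ 2 by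
    rw [Finset.sum_mul]; exact Finset.sum_congr rfl fun x _ => by split_ifs <;> simp, sum_ite_one_eq]
  split_ifs <;> simp

/-- **THE DIRICHLET-LAPLACIAN PART OF THE FORM, BY PARTS**: for `v` supported in a finite `S ⊂ ℤᵈ` and each direction `μ`,
`Σ_{x,z∈S} v(x)(2[z=x] − [z=x+e_μ] − [z=x−e_μ])v(z) = Σ_{x∈S}(v(x) − v(x+e_μ))² + Σ_{x∈S, x−e_μ∉S} v(x)²` — the second sum is the Dirichlet
boundary term. [cite: Balaban1985BackgroundPropagators, (3.23)–(3.24) p.394; Balaban1984PropagatorsII, p.235] -/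
theorem quadForm_lap_flat_eq (S : Finset (Fin d → ℤ)) (v : (Fin d → ℤ) → ℝ) (hv : ∀ w, w ∉ S → v w = 0) (μ : Fin d) :
    ∑ x ∈ S, ∑ z ∈ S, v x * ((2 : ℝ) * (if z = x then (1 : ℝ) else 0) - (if z = x + e μ then (1 : ℝ) else 0)
        - (if z = x - e μ then (1 : ℝ) else 0)) * v z =
      ∑ x ∈ S, (v x - v (x + e μ)) ^ 2 + ∑ x ∈ S, (if x - e μ ∈ S then 0 else v x ^ 2) := by
  have inner : ∀ x, ∑ z ∈ S, v x * ((2 : ℝ) * (if z = x then (1 : ℝ) else 0) - (if z = x + e μ then (1 : ℝ) else 0)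
      - (if z = x - e μ then (1 : ℝ) else 0)) * v z = 2 * (v x * v x) - v x * v (x + e μ) - v x * v (x - e μ) := by
    intro x
    have hx0 := sum_ite_eq_of_supp S v hv x
    have hxp := sum_ite_eq_of_supp S v hv (x + e μ)
    have hxm := sum_ite_eq_of_supp S v hv (x - e μ)
    have : ∀ z, v x * ((2 : ℝ) * (if z = x then (1 : ℝ) else 0) - (if z = x + e μ then (1 : ℝ) else 0)
        - (if z = x - e μ then (1 : ℝ) else 0)) * v z =
        2 * (v x * (if z = x then v z else 0)) - v x * (if z = x + e μ then v z else 0)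
          - v x * (if z = x - e μ then v z else 0) := by
      intro z; split_ifs <;> ring
    rw [Finset.sum_congr rfl fun z _ => this z, Finset.sum_sub_distrib, Finset.sum_sub_distrib, ← Finset.mul_sum, ← Finset.mul_sum,
      ← Finset.mul_sum, ← Finset.mul_sum, hx0, hxp, hxm]
  rw [Finset.sum_congr rfl fun x _ => inner x, Finset.sum_sub_distrib, Finset.sum_sub_distrib, sum_mul_shift_eq S v hv μ]
  have hsq : ∑ x ∈ S, (v x - v (x + e μ)) ^ 2 =
      ∑ x ∈ S, v x * v x - 2 * ∑ x ∈ S, v x * v (x + e μ) + ∑ x ∈ S, v (x + e μ) ^ 2 := by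
    rw [Finset.mul_sum, ← Finset.sum_sub_distrib, ← Finset.sum_add_distrib]
    exact Finset.sum_congr rfl fun x _ => by ring
  have hsplit : ∑ x ∈ S, (if x - e μ ∈ S then v x ^ 2 else 0) + ∑ x ∈ S, (if x - e μ ∈ S then 0 else v x ^ 2) =
      ∑ x ∈ S, v x * v x := by
    rw [← Finset.sum_add_distrib]
    exact Finset.sum_congr rfl fun x _ => by split_ifs <;> ring
  rw [hsq, sum_sq_shift_eq S v hv μ, ← Finset.mul_sum]
  linarith [hsplit]

/-- The Dirichlet-Laplacian part of the form is non-negative. [cite: Balaban1984PropagatorsII, p.235] -/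
theorem quadForm_lap_flat_nonneg (S : Finset (Fin d → ℤ)) (v : (Fin d → ℤ) → ℝ) (hv : ∀ w, w ∉ S → v w = 0) (μ : Fin d) :
    0 ≤ ∑ x ∈ S, ∑ z ∈ S, v x * ((2 : ℝ) * (if z = x then (1 : ℝ) else 0) - (if z = x + e μ then (1 : ℝ) else 0)
        - (if z = x - e μ then (1 : ℝ) else 0)) * v z := by
  rw [quadForm_lap_flat_eq S v hv μ]
  exact add_nonneg (Finset.sum_nonneg fun x _ => sq_nonneg _)
    (Finset.sum_nonneg fun x _ => by split_ifs <;> positivity)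

/-! ## §2 Vanishing of the Dirichlet-Laplacian part forces `v = 0` on a finite region -/

/-- **THE DIRICHLET BOUNDARY KILLS THE KERNEL**: on a FINITE `S`, if `Σ_{x∈S}(v(x) − v(x+e_μ))² + Σ_{x∈S, x−e_μ∉S} v(x)² = 0` for one direction
`μ` then `v = 0` (every site leaves `S` after finitely many steps along `−e_μ`; along the way `v` is constant and it vanishes at the exit site).
[cite: Balaban1984PropagatorsII, p.235; Balaban1985BackgroundPropagators, (3.24) p.394] -/
theorem eq_zero_of_lapForm_eq_zero (S : Finset (Fin d → ℤ)) (v : (Fin d → ℤ) → ℝ) (hv : ∀ w, w ∉ S → v w = 0) (μ : Fin d)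
    (h0 : ∑ x ∈ S, (v x - v (x + e μ)) ^ 2 + ∑ x ∈ S, (if x - e μ ∈ S then 0 else v x ^ 2) = 0) (w : Fin d → ℤ) :
    v w = 0 := by
  have hA0 : ∑ x ∈ S, (v x - v (x + e μ)) ^ 2 = 0 := by
    have h1 : 0 ≤ ∑ x ∈ S, (v x - v (x + e μ)) ^ 2 := Finset.sum_nonneg fun x _ => sq_nonneg _
    have h2 : 0 ≤ ∑ x ∈ S, (if x - e μ ∈ S then 0 else v x ^ 2) := Finset.sum_nonneg fun x _ => by split_ifs <;> positivity
    linarith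
  have hB0 : ∑ x ∈ S, (if x - e μ ∈ S then 0 else v x ^ 2) = 0 := by linarith
  have hA : ∀ x ∈ S, v x = v (x + e μ) := by
    intro x hx
    have h2 := (Finset.sum_eq_zero_iff_of_nonneg fun x _ => sq_nonneg (v x - v (x + e μ))).mp hA0 x hx
    exact sub_eq_zero.mp ((pow_eq_zero_iff two_ne_zero).mp h2)
  have hB : ∀ x ∈ S, x - e μ ∉ S → v x = 0 := by
    intro x hx hxe
    have := (Finset.sum_eq_zero_iff_of_nonneg fun x _ => by split_ifs <;> positivity).mp hB0 x hx
    rw [if_neg hxe] at this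
    exact (pow_eq_zero_iff two_ne_zero).mp this
  -- the walk along `−e_μ`
  have walk : ∀ n : ℕ, ∀ x ∈ S, x - (n : ℤ) • e μ ∉ S → v x = 0 := by
    intro n
    induction n with
    | zero =>
      intro x hx hn
      simp only [Nat.cast_zero, zero_smul, sub_zero] at hn
      exact absurd hx hn
    | succ n ih =>
      intro x hx hn
      by_cases hxe : x - e μ ∈ S
      · have hn' : x - e μ - (n : ℤ) • e μ ∉ S := by
          have : x - e μ - (n : ℤ) • e μ = x - ((n + 1 : ℕ) : ℤ) • e μ := by
            push_cast
            rw [add_smul, one_smul]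
            abel
          rwa [this]
        have h1 := ih (x - e μ) hxe hn'
        rw [hA (x - e μ) hxe, sub_add_cancel] at h1
        exact h1
      · exact hB x hx hxe
  by_cases hw : w ∈ S
  · -- exit index from finiteness of `S`
    have hinj : Function.Injective fun n : ℕ => w - (n : ℤ) • e μ := by
      intro n n' h
      have h' := congrFun h μ
      simp only [Pi.sub_apply, Pi.smul_apply, e, Pi.single_eq_same, smul_eq_mul, mul_one, sub_right_inj] at h'
      exact_mod_cast h'
    obtain ⟨a, ⟨n, rfl⟩, hn⟩ := (Set.infinite_range_of_injective hinj).exists_notMem_finset S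
    exact walk n w hw hn
  · exact hv w hw

/-! ## §3 The averaging part is a Gram form -/

open Classical in
/-- **THE AVERAGING PART `Q′ᵀaQ′` IS NON-NEGATIVE** (one level): for any block map `y(·)`, set `Λ` and weight `c ≥ 0`,
`Σ_{x,z∈S} v(x)[y(x) ∈ Λ ∧ y(z) = y(x)]c·v(z) = c·Σ_{y}[y ∈ Λ](Σ_{x∈S, y(x)=y} v(x))² ≥ 0`.
[cite: Balaban1985BackgroundPropagators, (3.24) p.394; Balaban1984PropagatorsII, p.235] -/
theorem quadForm_gram_nonneg (S : Finset (Fin d → ℤ)) (v : (Fin d → ℤ) → ℝ) (bm : (Fin d → ℤ) → (Fin d → ℤ)) (Λ : Set (Fin d → ℤ))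
    {c : ℝ} (hc : 0 ≤ c) :
    0 ≤ ∑ x ∈ S, ∑ z ∈ S, v x * (if bm x ∈ Λ ∧ bm z = bm x then c else 0) * v z := by
  set W : (Fin d → ℤ) → ℝ := fun y => ∑ z ∈ S, (if bm z = y then v z else 0) with hW
  have inner : ∀ x, ∑ z ∈ S, v x * (if bm x ∈ Λ ∧ bm z = bm x then c else 0) * v z =
      if bm x ∈ Λ then c * v x * W (bm x) else 0 := by
    intro x
    by_cases hP : bm x ∈ Λ
    · rw [if_pos hP]
      simp only [hW, Finset.mul_sum]
      exact Finset.sum_congr rfl fun z _ => by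
        by_cases hz : bm z = bm x
        · rw [if_pos ⟨hP, hz⟩, if_pos hz]; ring
        · rw [if_neg (fun h => hz h.2), if_neg hz]; ring
    · rw [if_neg hP]
      exact Finset.sum_eq_zero fun z _ => by rw [if_neg (fun h => hP h.1)]; ring
  rw [Finset.sum_congr rfl fun x _ => inner x,
    ← Finset.sum_fiberwise_of_maps_to (s := S) (t := S.image bm) (g := bm) fun x hx => Finset.mem_image_of_mem bm hx]
  refine Finset.sum_nonneg fun y _ => ?_
  have hWy : ∑ x ∈ S.filter (fun x => bm x = y), v x = W y := by
    rw [Finset.sum_filter]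
  have h1 : ∑ x ∈ S.filter (fun x => bm x = y), (if bm x ∈ Λ then c * v x * W (bm x) else 0) =
      ∑ x ∈ S.filter (fun x => bm x = y), (if y ∈ Λ then c * W y * v x else 0) :=
    Finset.sum_congr rfl fun x hx => by
      have hx' : bm x = y := (Finset.mem_filter.mp hx).2
      rw [hx']
      split_ifs <;> ring
  have hfib : ∑ x ∈ S.filter (fun x => bm x = y), (if bm x ∈ Λ then c * v x * W (bm x) else 0) =
      if y ∈ Λ then c * (W y * W y) else 0 := by
    rw [h1]
    by_cases hy : y ∈ Λ
    · simp only [if_pos hy]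
      rw [← Finset.mul_sum, hWy, mul_assoc]
    · simp only [if_neg hy, Finset.sum_const_zero]
  rw [hfib]
  split_ifs
  · exact mul_nonneg hc (mul_self_nonneg _)
  · exact le_refl _

/-! ## §4 The whole form: vanishing forces `v = 0` -/

open Classical in
/-- **THE FLAT DIRICHLET FORM IS DEFINITE**: with the kernel `K` of `B8Eq191FlatStencils.flatDirichletOp_eq_sum_of_supp` (`η ≠ 0`, level weights
`a_j ≥ 0`, `d ≥ 1`), for `v` supported in the finite `S`: `Σ_{x,z∈S} v(x)K(x,z)v(z) = 0 ⇒ v = 0`.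
[cite: Balaban1984PropagatorsII, p.235 («positive definite, so its inverse is well defined»); Balaban1985BackgroundPropagators, (3.24)–(3.25) p.394; Balaban1985RegularSpaces, (1.91) p.91] -/
theorem eq_zero_of_quadForm_flat_eq_zero (hd : 0 < d) {η : ℝ} (hη : η ≠ 0) (L m : ℕ) (Λs : ℕ → Set (Fin d → ℤ)) (a : ℕ → ℝ)
    (ha : ∀ j, 0 ≤ a j) (K : (Fin d → ℤ) → (Fin d → ℤ) → ℝ)
    (hK : ∀ x z, K x z = ((η ^ 2)⁻¹ * ∑ μ : Fin d, ((2 : ℝ) * (if z = x then (1 : ℝ) else 0) - (if z = x + e μ then (1 : ℝ) else 0)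
        - (if z = x - e μ then (1 : ℝ) else 0))) +
        (∑ j ∈ Finset.range (m + 1), (if blockMap (L ^ j) x ∈ Λs j ∧ blockMap (L ^ j) z = blockMap (L ^ j) x then
          a j * ((((L : ℝ) ^ d)⁻¹) ^ j) ^ 2 else 0)))
    (S : Finset (Fin d → ℤ)) (v : (Fin d → ℤ) → ℝ) (hv : ∀ w, w ∉ S → v w = 0)
    (h0 : ∑ x ∈ S, ∑ z ∈ S, v x * K x z * v z = 0) (w : Fin d → ℤ) : v w = 0 := by
  -- pointwise split of the summand
  have hterm : ∀ x z, v x * K x z * v z =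
      (η ^ 2)⁻¹ * ∑ μ : Fin d, v x * ((2 : ℝ) * (if z = x then (1 : ℝ) else 0)
        - (if z = x + e μ then (1 : ℝ) else 0) - (if z = x - e μ then (1 : ℝ) else 0)) * v z +
      ∑ j ∈ Finset.range (m + 1), v x * (if blockMap (L ^ j) x ∈ Λs j ∧ blockMap (L ^ j) z = blockMap (L ^ j) x
        then a j * ((((L : ℝ) ^ d)⁻¹) ^ j) ^ 2 else 0) * v z := by
    intro x z
    rw [hK, mul_add, add_mul]
    congr 1
    · simp only [Finset.mul_sum, Finset.sum_mul]
      exact Finset.sum_congr rfl fun μ _ => by ring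
    · simp only [Finset.mul_sum, Finset.sum_mul]
  have hx : ∑ x ∈ S, ∑ z ∈ S, v x * K x z * v z =
      ∑ x ∈ S, ∑ z ∈ S, ((η ^ 2)⁻¹ * ∑ μ : Fin d, v x * ((2 : ℝ) * (if z = x then (1 : ℝ) else 0)
        - (if z = x + e μ then (1 : ℝ) else 0) - (if z = x - e μ then (1 : ℝ) else 0)) * v z) +
      ∑ x ∈ S, ∑ z ∈ S, ∑ j ∈ Finset.range (m + 1), v x * (if blockMap (L ^ j) x ∈ Λs j ∧
        blockMap (L ^ j) z = blockMap (L ^ j) x then a j * ((((L : ℝ) ^ d)⁻¹) ^ j) ^ 2 else 0) * v z := by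
    rw [← Finset.sum_add_distrib]
    refine Finset.sum_congr rfl fun x _ => ?_
    rw [← Finset.sum_add_distrib]
    exact Finset.sum_congr rfl fun z _ => hterm x z
  have hA : ∑ x ∈ S, ∑ z ∈ S, ((η ^ 2)⁻¹ * ∑ μ : Fin d, v x * ((2 : ℝ) * (if z = x then (1 : ℝ) else 0)
        - (if z = x + e μ then (1 : ℝ) else 0) - (if z = x - e μ then (1 : ℝ) else 0)) * v z) =
      (η ^ 2)⁻¹ * ∑ μ : Fin d, ∑ x ∈ S, ∑ z ∈ S, v x * ((2 : ℝ) * (if z = x then (1 : ℝ) else 0)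
        - (if z = x + e μ then (1 : ℝ) else 0) - (if z = x - e μ then (1 : ℝ) else 0)) * v z := by
    simp_rw [← Finset.mul_sum]
    congr 1
    simp_rw [Finset.sum_comm (s := S) (t := (Finset.univ : Finset (Fin d)))]
  have hB : ∑ x ∈ S, ∑ z ∈ S, ∑ j ∈ Finset.range (m + 1), v x * (if blockMap (L ^ j) x ∈ Λs j ∧
        blockMap (L ^ j) z = blockMap (L ^ j) x then a j * ((((L : ℝ) ^ d)⁻¹) ^ j) ^ 2 else 0) * v z =
      ∑ j ∈ Finset.range (m + 1), ∑ x ∈ S, ∑ z ∈ S, v x * (if blockMap (L ^ j) x ∈ Λs j ∧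
        blockMap (L ^ j) z = blockMap (L ^ j) x then a j * ((((L : ℝ) ^ d)⁻¹) ^ j) ^ 2 else 0) * v z := by
    simp_rw [Finset.sum_comm (s := S) (t := Finset.range (m + 1))]
  have hsplit : ∑ x ∈ S, ∑ z ∈ S, v x * K x z * v z =
      (η ^ 2)⁻¹ * ∑ μ : Fin d, ∑ x ∈ S, ∑ z ∈ S, v x * ((2 : ℝ) * (if z = x then (1 : ℝ) else 0)
        - (if z = x + e μ then (1 : ℝ) else 0) - (if z = x - e μ then (1 : ℝ) else 0)) * v z +
      ∑ j ∈ Finset.range (m + 1), ∑ x ∈ S, ∑ z ∈ S, v x * (if blockMap (L ^ j) x ∈ Λs j ∧ blockMap (L ^ j) z = blockMap (L ^ j) x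
        then a j * ((((L : ℝ) ^ d)⁻¹) ^ j) ^ 2 else 0) * v z := by
    rw [hx, hA, hB]
  rw [hsplit] at h0
  have hlap : ∀ μ : Fin d, 0 ≤ ∑ x ∈ S, ∑ z ∈ S, v x * ((2 : ℝ) * (if z = x then (1 : ℝ) else 0)
      - (if z = x + e μ then (1 : ℝ) else 0) - (if z = x - e μ then (1 : ℝ) else 0)) * v z :=
    fun μ => quadForm_lap_flat_nonneg S v hv μ
  have hgram : ∀ j, 0 ≤ ∑ x ∈ S, ∑ z ∈ S, v x * (if blockMap (L ^ j) x ∈ Λs j ∧ blockMap (L ^ j) z = blockMap (L ^ j) x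
      then a j * ((((L : ℝ) ^ d)⁻¹) ^ j) ^ 2 else 0) * v z :=
    fun j => quadForm_gram_nonneg S v (blockMap (L ^ j)) (Λs j) (mul_nonneg (ha j) (sq_nonneg _))
  have hη2 : 0 < (η ^ 2)⁻¹ := inv_pos.mpr (by positivity)
  have h1 : 0 ≤ ∑ μ : Fin d, ∑ x ∈ S, ∑ z ∈ S, v x * ((2 : ℝ) * (if z = x then (1 : ℝ) else 0)
      - (if z = x + e μ then (1 : ℝ) else 0) - (if z = x - e μ then (1 : ℝ) else 0)) * v z := Finset.sum_nonneg fun μ _ => hlap μ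
  have h2 : 0 ≤ ∑ j ∈ Finset.range (m + 1), ∑ x ∈ S, ∑ z ∈ S, v x * (if blockMap (L ^ j) x ∈ Λs j ∧
      blockMap (L ^ j) z = blockMap (L ^ j) x then a j * ((((L : ℝ) ^ d)⁻¹) ^ j) ^ 2 else 0) * v z :=
    Finset.sum_nonneg fun j _ => hgram j
  have hsum0 : ∑ μ : Fin d, ∑ x ∈ S, ∑ z ∈ S, v x * ((2 : ℝ) * (if z = x then (1 : ℝ) else 0)
      - (if z = x + e μ then (1 : ℝ) else 0) - (if z = x - e μ then (1 : ℝ) else 0)) * v z = 0 := by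
    nlinarith [mul_nonneg hη2.le h1]
  have hμ0 := (Finset.sum_eq_zero_iff_of_nonneg fun μ _ => hlap μ).mp hsum0 ⟨0, hd⟩ (Finset.mem_univ _)
  rw [quadForm_lap_flat_eq S v hv ⟨0, hd⟩] at hμ0
  exact eq_zero_of_lapForm_eq_zero S v hv ⟨0, hd⟩ hμ0 w

/-! ## §5 The real matrix of the flat Dirichlet operator is a unit -/

open Classical in
/-- **`mulVec` of the flat Dirichlet matrix `(K(x,z))_{x,z∈S}` is injective** (definite form ⇒ trivial kernel).
[cite: Balaban1984PropagatorsII, p.235; Balaban1985RegularSpaces, (1.91) p.91] -/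
theorem flatMatrix_mulVec_injective (hd : 0 < d) {η : ℝ} (hη : η ≠ 0) (L m : ℕ) (Λs : ℕ → Set (Fin d → ℤ)) (a : ℕ → ℝ)
    (ha : ∀ j, 0 ≤ a j) (K : (Fin d → ℤ) → (Fin d → ℤ) → ℝ)
    (hK : ∀ x z, K x z = ((η ^ 2)⁻¹ * ∑ μ : Fin d, ((2 : ℝ) * (if z = x then (1 : ℝ) else 0) - (if z = x + e μ then (1 : ℝ) else 0)
        - (if z = x - e μ then (1 : ℝ) else 0))) +
        (∑ j ∈ Finset.range (m + 1), (if blockMap (L ^ j) x ∈ Λs j ∧ blockMap (L ^ j) z = blockMap (L ^ j) x then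
          a j * ((((L : ℝ) ^ d)⁻¹) ^ j) ^ 2 else 0)))
    (S : Finset (Fin d → ℤ)) :
    Function.Injective (Matrix.of fun x z : ↥S => K x.1 z.1).mulVec := by
  intro u₁ u₂ h12
  set u : ↥S → ℝ := u₁ - u₂ with hu
  have hTu : (Matrix.of fun x z : ↥S => K x.1 z.1).mulVec u = 0 := by
    rw [hu, Matrix.mulVec_sub, h12, sub_self]
  -- the zero extension of `u`
  set v : (Fin d → ℤ) → ℝ := fun w => if hw : w ∈ S then u ⟨w, hw⟩ else 0 with hvdef
  have hv : ∀ w, w ∉ S → v w = 0 := fun w hw => by rw [hvdef]; exact dif_neg hw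
  have hvS : ∀ x : ↥S, v x.1 = u x := fun x => by rw [hvdef]; exact dif_pos x.2
  have hform : ∑ x ∈ S, ∑ z ∈ S, v x * K x z * v z = 0 := by
    rw [← Finset.sum_coe_sort S]
    have : ∀ x : ↥S, ∑ z ∈ S, v x.1 * K x.1 z * v z = u x * (Matrix.of fun x z : ↥S => K x.1 z.1).mulVec u x := by
      intro x
      rw [← Finset.sum_coe_sort S]
      simp only [Matrix.mulVec, dotProduct, Matrix.of_apply, Finset.mul_sum]
      exact Finset.sum_congr rfl fun z _ => by rw [hvS x, hvS z]; ring
    rw [Finset.sum_congr rfl fun x _ => this x, hTu]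
    simp
  have hv0 : ∀ w, v w = 0 := eq_zero_of_quadForm_flat_eq_zero hd hη L m Λs a ha K hK S v hv hform
  have hu0 : u = 0 := funext fun x => by rw [← hvS x, hv0]; rfl
  rw [hu] at hu0
  exact sub_eq_zero.mp hu0

open Classical in
/-- **THE FLAT DIRICHLET MATRIX IS A UNIT** — the existence of `G′(1) = (Δ_{Ω₀} + Q′ᵀaQ′)⁻¹` at the flat background on a finite region.
[cite: Balaban1985RegularSpaces, (1.91) p.91, (1.95) p.92; Balaban1984PropagatorsII, p.235; Balaban1985BackgroundPropagators, (3.24)–(3.25) p.394] -/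
theorem isUnit_flatMatrix (hd : 0 < d) {η : ℝ} (hη : η ≠ 0) (L m : ℕ) (Λs : ℕ → Set (Fin d → ℤ)) (a : ℕ → ℝ)
    (ha : ∀ j, 0 ≤ a j) (K : (Fin d → ℤ) → (Fin d → ℤ) → ℝ)
    (hK : ∀ x z, K x z = ((η ^ 2)⁻¹ * ∑ μ : Fin d, ((2 : ℝ) * (if z = x then (1 : ℝ) else 0) - (if z = x + e μ then (1 : ℝ) else 0)
        - (if z = x - e μ then (1 : ℝ) else 0))) +
        (∑ j ∈ Finset.range (m + 1), (if blockMap (L ^ j) x ∈ Λs j ∧ blockMap (L ^ j) z = blockMap (L ^ j) x then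
          a j * ((((L : ℝ) ^ d)⁻¹) ^ j) ^ 2 else 0)))
    (S : Finset (Fin d → ℤ)) :
    IsUnit (Matrix.of fun x z : ↥S => K x.1 z.1) :=
  Matrix.mulVec_injective_iff_isUnit.mp (flatMatrix_mulVec_injective hd hη L m Λs a ha K hK S)

end Literature.MathematicalPhysics.QuantumFieldTheory.Balaban1983to89.B8Eq191FlatDirichletForm

end
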